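import Literature.FieldTheory.AlgClosed.AutomorphismExtension
import Literature.NumberTheory.Automorphic.RealMatrixGroups
import Mathlib.Algebra.Order.Archimedean.Real.Hom
import HarnessLib

/-!
# Wild star-formally-real involutions of `ℂ`
# (the binder `[StarRing A]` of `automorphicForms_isStableSubmodule` is wider than the source's)

Topic `NumberTheory/Automorphic`; companion of `RealMatrixGroups` (the predicate
`IsStarFormallyReal A`) and of `AutomorphicForms` (the named fact
`automorphicForms_isStableSubmodule 𝒟`, Borel–Jacquet 1979, 4.3). That fact quantifies over an
arbitrary `StarRing` structure on the finite-dimensional coefficient algebra `A`, constrained only by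
the regularity hypotheses `AutomorphyDatum.IsRegular` (among them `IsStarFormallyReal A`); the source
works with `A = K ⊗_ℚ ℝ ≅ ℝ^{r₁} × ℂ^{r₂}` and its standard — `ℝ`-linear, continuous — involution,
and every proof of 4.3 (Harish-Chandra's `φ = φ ∗ α`, or interior elliptic regularity as in
`AutomorphicFormsStableHolds`) uses that `ℝ`-linearity (compactness of `K_∞ = G_∞ ∩ U(N, A)`,
definiteness of the trace form on `𝔨` and `𝔭`). This file PROVES that the formal hypothesis class is
strictly larger: conjugating complex conjugation by an automorphism of `ℂ` outside `{id, conj}`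
(these exist: `Aut(ℂ)` is transitive on transcendental numbers, `AutomorphismExtension`) gives an
involutive ring automorphism `τ` of `ℂ` which is star-formally real (`∑ τ(xᵢ) xᵢ = 0 ⇒ xᵢ = 0`) but
moves some real number, hence a `StarRing ℂ` structure satisfying `IsStarFormallyReal ℂ` and not
`StarModule ℝ ℂ`:

* `Complex.exists_transcendental` — a transcendental complex number exists (countability);
* `Complex.ringEquiv_id_or_conj_of_forall_ofReal` — an automorphism of `ℂ` fixing `ℝ` pointwise is
  `id` or `conj`;
* `Complex.exists_ringEquiv_apply_ofReal_ne` — some automorphism of `ℂ` moves a real number;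
* `Complex.exists_involutive_formallyReal_apply_ofReal_ne` — the wild star-formally-real involution;
* `exists_starRing_isStarFormallyReal_not_starModule` — packaged as a `StarRing ℂ` structure.

So the discharge `automorphicForms_isStableSubmodule_holds_of_starModule [StarModule ℝ A]`
(`AutomorphicFormsStableHolds`) covers exactly the source's setting, and the hypothesis
`[StarModule ℝ A]` it adds is not a consequence of `IsRegular`. Everything here is proved; no
definitions, no named facts.

## References

* A. Borel, H. Jacquet, *Automorphic forms and automorphic representations*, Proc. Sympos. Pure
  Math. 33.1 (1979), 4.1 (the setting `G_∞ ⊂ GL_N(K ⊗ ℝ)`) and 4.3 [BorelJacquetCorvallis1979].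
* S. Lang, *Algebra*, rev. 3rd ed., GTM 211 (2002), Ch. VIII §1 (automorphisms of `ℂ` via
  transcendence bases); D. A. Cox, *Primes of the form x² + ny²*, 2nd ed. (2013), proof of
  Thm. 10.23 [Cox2013].
* E. Artin, O. Schreier, *Algebraische Konstruktion reeller Körper*, Abh. Math. Sem. Hamburg 5
  (1927) (fixed fields of involutions of algebraically closed fields are real closed).
-/

noncomputable section

open Complex ComplexConjugate Polynomial

namespace Literature.NumberTheory.Automorphic

/-- **There is a transcendental complex number**: the algebraic numbers form a countable set (a
countable union over `ℚ[X]` of finite root sets) and `ℂ` is uncountable. Cantor 1874. [folklore] -/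
theorem Complex.exists_transcendental : ∃ x : ℂ, Transcendental ℚ x := by
  by_contra h
  push Not at h
  have huniv : (Set.univ : Set ℂ).Countable := by
    haveI : Countable ℚ[X] :=
      Cardinal.mk_le_aleph0_iff.mp (Polynomial.cardinalMk_le_max.trans (by simp))
    have hsub : (Set.univ : Set ℂ) ⊆ ⋃ p : ℚ[X], p.rootSet ℂ := by
      intro y _
      have hy : IsAlgebraic ℚ y := not_not.mp (h y)
      obtain ⟨p, hp0, hpy⟩ := hy
      exact Set.mem_iUnion.2 ⟨p, Polynomial.mem_rootSet.2 ⟨hp0, hpy⟩⟩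
    exact (Set.countable_iUnion fun p ↦ (Polynomial.rootSet_finite p ℂ).countable).mono hsub
  exact not_countable_complex huniv

/-- **An automorphism of `ℂ` fixing `ℝ` pointwise is the identity or complex conjugation** (it is
then an `ℝ`-algebra endomorphism; `Complex.real_algHom_eq_id_or_conj`). [folklore] -/
theorem Complex.ringEquiv_id_or_conj_of_forall_ofReal {σ : ℂ ≃+* ℂ} (hσ : ∀ r : ℝ, σ r = r) :
    (∀ z, σ z = z) ∨ ∀ z, σ z = conj z := by
  let f : ℂ →ₐ[ℝ] ℂ := AlgHom.mk' σ.toRingHom fun (c : ℝ) z ↦ by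
    simp only [RingEquiv.toRingHom_eq_coe, RingHom.coe_coe, Complex.real_smul, map_mul, hσ]
  have hf : ∀ z, f z = σ z := fun _ ↦ rfl
  rcases Complex.real_algHom_eq_id_or_conj f with h | h
  · exact Or.inl fun z ↦ by rw [← hf, h]; rfl
  · exact Or.inr fun z ↦ by rw [← hf, h]; rfl

/-- **`Aut(ℂ) ≠ {id, conj}`: some automorphism of `ℂ` moves a real number.** For a transcendental
`x`, `x + 1` is transcendental, so some `σ ∈ Aut(ℂ)` has `σ x = x + 1`
(`Complex.exists_ringEquiv_apply_eq_of_transcendental`); such a `σ` is neither `id` nor `conj`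
(compare real parts), hence does not fix `ℝ` pointwise. Lang, *Algebra*, VIII §1. [folklore] -/
theorem Complex.exists_ringEquiv_apply_ofReal_ne : ∃ σ : ℂ ≃+* ℂ, ∃ r : ℝ, σ r ≠ r := by
  obtain ⟨x, hx⟩ := Complex.exists_transcendental
  have hx1 : Transcendental ℚ (x + 1) := fun h1 ↦
    hx (by simpa using h1.sub (isAlgebraic_one (R := ℚ) (A := ℂ)))
  obtain ⟨σ, hσ⟩ :=
    Literature.FieldTheory.AlgClosed.Complex.exists_ringEquiv_apply_eq_of_transcendental hx hx1
  refine ⟨σ, ?_⟩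
  by_contra h
  push Not at h
  rcases Complex.ringEquiv_id_or_conj_of_forall_ofReal h with h' | h'
  · have h1 : x = x + 1 := (h' x).symm.trans hσ
    have : (1 : ℂ) = 0 := by linear_combination -h1
    exact one_ne_zero this
  · have h1 : conj x = x + 1 := (h' x).symm.trans hσ
    have h2 := congrArg Complex.re h1
    rw [Complex.conj_re, Complex.add_re, Complex.one_re] at h2
    linarith

/-- **A wild star-formally-real involution of `ℂ`.** There is an involutive ring automorphism `τ`
of `ℂ` such that `∑ᵢ τ(xᵢ) xᵢ = 0` forces every `xᵢ = 0`, and which moves some real number (so it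
is neither `ℝ`-linear nor continuous, and differs from `id` and `conj`). Construction:
`τ = σ ∘ conj ∘ σ⁻¹` for `σ ∈ Aut(ℂ)` moving a real number; `σ⁻¹` carries `∑ τ(xᵢ) xᵢ` to
`∑ |σ⁻¹ xᵢ|²`; if `τ` fixed `ℝ` it would be `id` (impossible: `τ (σ i) = -σ i`) or `conj`, and then
`σ` would commute with `conj`, preserve `ℝ`, restrict to the unique ring endomorphism `id` of `ℝ`
— contradicting the choice of `σ`. (The fixed field of such a `τ` is a real closed field
`≠ ℝ`, Artin–Schreier 1927.) [folklore] -/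
theorem Complex.exists_involutive_formallyReal_apply_ofReal_ne :
    ∃ τ : ℂ ≃+* ℂ, Function.Involutive τ ∧
      (∀ (n : ℕ) (x : Fin n → ℂ), ∑ i, τ (x i) * x i = 0 → ∀ i, x i = 0) ∧ ∃ r : ℝ, τ r ≠ r := by
  obtain ⟨σ, r, hr⟩ := Complex.exists_ringEquiv_apply_ofReal_ne
  set c : ℂ ≃+* ℂ := Complex.conjAe.toRingEquiv with hc
  have hc_apply : ∀ z, c z = conj z := fun z ↦ rfl
  refine ⟨σ.symm.trans (c.trans σ), fun z ↦ ?_, fun n x hx i ↦ ?_, ?_⟩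
  · -- involutive
    simp only [RingEquiv.coe_trans, Function.comp_apply, RingEquiv.symm_apply_apply, hc_apply,
      Complex.conj_conj, RingEquiv.apply_symm_apply]
  · -- star-formally real: apply `σ⁻¹`
    have h := congrArg σ.symm hx
    simp only [map_sum, map_mul, map_zero, RingEquiv.coe_trans, Function.comp_apply,
      RingEquiv.symm_apply_apply, hc_apply] at h
    -- `h : ∑ i, conj (σ.symm (x i)) * σ.symm (x i) = 0`
    have h' : ∑ j, Complex.normSq (σ.symm (x j)) = 0 := by
      have : ∑ j, ((Complex.normSq (σ.symm (x j)) : ℝ) : ℂ) = 0 := by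
        rw [← h]
        exact Finset.sum_congr rfl fun j _ ↦ by rw [mul_comm, Complex.mul_conj]
      exact_mod_cast this
    have hi : Complex.normSq (σ.symm (x i)) = 0 :=
      (Finset.sum_eq_zero_iff_of_nonneg fun j _ ↦ Complex.normSq_nonneg _).1 h' i (Finset.mem_univ i)
    rw [Complex.normSq_eq_zero] at hi
    simpa using congrArg σ hi
  · -- moves a real number
    by_contra h
    push Not at h
    have hτ : ∀ w, (σ.symm.trans (c.trans σ)) (σ w) = σ (conj w) := fun w ↦ by
      simp only [RingEquiv.coe_trans, Function.comp_apply, RingEquiv.symm_apply_apply, hc_apply]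
    rcases Complex.ringEquiv_id_or_conj_of_forall_ofReal h with h' | h'
    · -- `τ = id`: `σ (conj I) = σ I`, i.e. `-σ I = σ I`
      have h1 := (hτ Complex.I).symm.trans (h' (σ Complex.I))
      rw [Complex.conj_I, map_neg, neg_eq_iff_add_eq_zero, ← two_mul, mul_eq_zero] at h1
      rcases h1 with h1 | h1
      · norm_num at h1
      · exact Complex.I_ne_zero (by simpa using congrArg σ.symm h1)
    · -- `τ = conj`: `σ` commutes with `conj`, hence preserves `ℝ` and fixes it pointwise
      have hcomm : ∀ w, σ (conj w) = conj (σ w) := fun w ↦ (hτ w).symm.trans (h' (σ w))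
      have him : ∀ s : ℝ, (σ s).im = 0 := fun s ↦ by
        have hs : conj (σ s) = σ s := by rw [← hcomm, Complex.conj_ofReal]
        exact Complex.conj_eq_iff_im.1 hs
      let ρ : ℝ →+* ℝ :=
        { toFun := fun s ↦ (σ s).re
          map_one' := by simp
          map_mul' := fun s t ↦ by
            simp only [Complex.ofReal_mul, map_mul, Complex.mul_re, him, mul_zero, sub_zero]
          map_zero' := by simp
          map_add' := fun s t ↦ by
            simp only [Complex.ofReal_add, map_add, Complex.add_re] }
      have hρ : (σ r).re = r := Real.ringHom_apply ρ r
      exact hr (Complex.ext (by rw [hρ, Complex.ofReal_re]) (by rw [him, Complex.ofReal_im]))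

/-- **A `StarRing` structure on `ℂ` which is star-formally real but not `ℝ`-linear.** Packaging
of `Complex.exists_involutive_formallyReal_apply_ofReal_ne`: with `star := τ`, the predicate
`IsStarFormallyReal ℂ` of `RealMatrixGroups` (the field `isStarFormallyReal` of
`AutomorphyDatum.IsRegular`) holds while `StarModule ℝ ℂ` fails (`star (r • 1) = τ r ≠ r`). Hence
the instance hypothesis `[StarModule ℝ A]` under which Borel–Jacquet 4.3 is discharged in the tree
(`automorphicForms_isStableSubmodule_holds_of_starModule`) is not implied by the hypotheses of the
named fact `automorphicForms_isStableSubmodule`; the source (Borel–Jacquet 1979, 4.1) has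
`A = K ⊗_ℚ ℝ` with its standard involution, where it holds. [folklore] -/
theorem exists_starRing_isStarFormallyReal_not_starModule :
    ∃ s : StarRing ℂ, @IsStarFormallyReal ℂ _ s ∧
      ¬ @StarModule ℝ ℂ _ s.toStarMul.toInvolutiveStar.toStar _ := by
  obtain ⟨τ, hτ, hfr, r, hr⟩ := Complex.exists_involutive_formallyReal_apply_ofReal_ne
  refine ⟨{ star := τ
            star_involutive := hτ
            star_mul := fun x y ↦ (map_mul τ x y).trans (mul_comm _ _)
            star_add := map_add τ }, fun n x hx ↦ hfr n x hx, fun hmod ↦ hr ?_⟩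
  have h := @StarModule.star_smul ℝ ℂ _ _ _ hmod r (1 : ℂ)
  change τ (r • (1 : ℂ)) = star r • τ 1 at h
  rwa [star_trivial, Complex.real_smul, Complex.real_smul, mul_one, map_one, mul_one] at h

end Literature.NumberTheory.Automorphic
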